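import Summits.BirchSwinnertonDyer.Rank1Residual.X11b.LocalTrivialityBridge
import Literature.NumberTheory.GaloisRepresentations.ContinuousShapiroLiftMackeyH1Equiv
import Literature.NumberTheory.GaloisRepresentations.ContinuousShapiroLiftMackeyH1
import Literature.NumberTheory.GaloisRepresentations.ContinuousShapiroLiftVanishing
import Literature.NumberTheory.GaloisRepresentations.ContinuousShapiroLiftFunctor
import Literature.NumberTheory.GaloisRepresentations.CoinducedDiscreteGaloisModule
import Literature.NumberTheory.EllipticCurves.GreenbergVatsal2000.GreenbergSelmerGroups
import Literature.NumberTheory.EllipticCurves.KummerSelmerStructure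
import Literature.NumberTheory.GaloisRepresentations.UnramifiedClassesInertia
import Mathlib.GroupTheory.DoubleCoset
import Literature.NumberTheory.GaloisRepresentations.ConjugationDescent
import Summits.BirchSwinnertonDyer.BirchSwinnertonDyer.Theorems.PrintCf2SplitBadTwoLayerShapiroUnramified
import Literature.NumberTheory.GaloisCohomology.KolyvaginSystems
import HarnessLib

/-!
# Crux `PrintCf2.SplitBadTwoRankOneOfFacts` (stmt-BirchSwinnertonDyer-20368), skeleton v13.1, stub S3n′ `stub_pseudoNullFinite_two`,
# S3N-FACTFREE brick R2, file 3 (B2b of `Cruxes/…/R2-BRICKS-w5g7.md`): THE COMPONENT READING — a LOCAL class of `Maps(Γ_K ⧸ U, M₀)`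
# at `w` with PRESCRIBED layer-local targets at every place of `K̄^U` above `w`, whose push-forward along `M₀ → M`, once matched by the
# Shapiro lift of a layer class `z ∈ H¹(U, M)` MODULO UNRAMIFIED classes, forces `res_{U ⊓ D_w}(conj_{q.out} z) ≡ j_* τ₀(q)` modulo classes
# dying on `U ⊓ I_w` — the first clause of (SUR_U) (memo §1) read through Shapiro/Mackey, in the LINE's currency

Cell `bsd-print-cf2`, WIDTH seat `bsd-line-cf2-p1-w5` g7 (prover-bsd-line-cf2-p1-w5-g7-0); `--supports stmt-BirchSwinnertonDyer-20368`
(helper, Theses-free). HONEST FRAMING: nothing here closes the crux or a registered stub; BSD is not proved by any of this; no summit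
statement is proved by this seat. No definition, no named fact, no `sorry`. Unconditional.

SETTING (as in file 2 `…LayerShapiroUnramified`): `K` a number field; `M₀ →j M` an equivariant additive map of discrete `Γ_K`-modules with
open stabilisers (two LEVELS `A[p^k] ↪ A[p^m]` in the application), `ιc : Maps(Γ_K ⧸ U, M₀) →ⁱ Maps(Γ_K ⧸ U, M)` the induced intertwining
map of the coinduced modules (`hιc : ιc φ y = j (φ y)`; any packaging, e.g. obtained once by the consumer as an `∃`); `U ⊴ Γ_K` open of
finite index with representatives `s`, `s 1 = 1`; `w` a finite place, `θ_w = absGaloisRestrict K K_w`, `D_w = decomp w = θ_w(Γ_{K_w})`,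
`I_w = θ_w(absInertia K_w)`; the places of `F = K̄^U` above `w` = the double cosets `D_w \ Γ_K / U` (`DoubleCoset.Quotient ↑(decomp w) ↑U`,
representatives `q.out`, -w4 g12 / -w8 g4 convention).

WHAT.
* §1 **`bijective_quotientMapOfHom_mul_out`** (generic groups): for `N ⊴ G`, `θ : D → G` and `Δ = θ(D)`, `(q, y') ↦ ē(y')·(q.out N)` is a
  BIJECTION `(Δ \ G / N) × (D ⧸ θ⁻¹N) ≃ G ⧸ N` — the orbit representatives `g := Quotient.out` satisfy the `hbij` hypothesis of the tree's
  Mackey theorems (`ContinuousShapiroLiftMackeyH1.exists_cohomologyMap_resCoindFinHomR_eq(_shapiroLift)`, `cupProduct_map_shapiroLift_eq_sum_orbits`).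
* §2 **`exists_localClass_reading`** — THE COMPONENT READING, two levels at once: for targets `τ₀ q ∈ H¹(U ⊓ D_w, M₀)` there is a local
  class `t₀ ∈ H¹(K_w, Maps(Γ_K ⧸ U, M₀))` (built by Mackey joint surjectivity with components the `D`-level Shapiro lifts of the pull-backs
  of the `τ₀ q` along `π : θ_w⁻¹U ↠ U ⊓ D_w`) such that for EVERY `z ∈ H¹(U, M)`:
  `loc_w (Sh z) − H¹(ιc_w) t₀ ∈ H¹_ur(K_w, Maps(Γ_K ⧸ U, M))` ⟹ ∀ q,
  `resOfLe (inertiaIn ≤ decompIn) (resH1Hom (decompInToH U w) id (conjH1 U M q.out z) − j_* (τ₀ q)) = 0`.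
  Proof (all on cocycles): the `q`-component `H¹(Φ_{q.out})` of the unramified difference dies on `absInertia K_w` (equivariance of `Φ`);
  `H¹(Φ_q)(loc_w Sh z) = Sh^D(θ_U^*(q.out · z))` (`map_resCoindFinHomR_shapiroLift`); `H¹(Φ_q)(H¹(ιc) t₀) = Sh^D(j_* b_q)` (naturality of `Φ_q`
  in the coefficients, `hιc`, + `shapiroLift_cohomologyMap` + the prescribed components); ORBIT DETECTION for the `D`-level Shapiro lift at
  `γ = 1` (`map_comapCoeffHom_conjMap_eq_zero_of_map_shapiroLift_eq_zero`, `conjMap_eq_self_of_mem_one`) makes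
  `θ_U^*(q.out · z) − j_* b_q` principal on `θ_w⁻¹U ⊓ absInertia`, which covers `U ⊓ I_w ⊓ D_w` (`inertia w = (absInertia K_w).map θ_w`).
  The «unramified» ↔ «principal on `absInertia`» step is file 2's dictionary (`oneCocycleClass_mem_unramifiedSubgroup_iff_exists`), the
  Literature/Mackey identifications `galoisCohomology (ρ.coind U hU).toLocal (inr w)) 1 = continuousCohomology 1 (TopRep.res θ_w (coindFin _ U))`
  and `localization = ContinuousCohomology.map θ_w (𝟙 _) 1` are `rfl`.
USE (R2 assembly B2c): with `𝓖_w = ⊤`, `𝓕_w = unramified` at `w ∈ T` and the test family `t_w := H¹(ι_w) t₀(w)`, Poitou–Tate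
(`ProNullLift.exists_selmer_sub_localMap_mem_canonical_of_dualPullback_eq_zero`, p700098) returns `x = Sh z` with `loc_w x − t_w ∈ 𝓕_w`; this file
turns that into the first clause of (SUR_U) for the targets `j_* τ₀(q)`, file 2 turns `loc_w x ∈ 𝓕_w` (`w ∉ T`) into the second clause.
presearch: Brown III (5.6)(b); NSW (1.5.6)–(1.5.7), (1.6.4)–(1.6.5); bsd-wall RTT S₀-Mackey package (`…MackeyPackageGlue`); no new fact.
beyond-print theorem: no.

References: [Brown1982] III §5 (5.6)(b); [NeukirchSchmidtWingberg2008] I §5 (1.5.6)–(1.5.7), I §6 (1.6.4)–(1.6.5); [MilneADT2006] I §2;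
[GreenbergVatsal2000] §2 Prop. 2.1; [SerreLocalFields1979] VII §5–§6.
-/

noncomputable section

open scoped Classical ContRepresentation

set_option linter.dupNamespace false
set_option autoImplicit false

open CategoryTheory NumberField IsDedekindDomain Field ValuativeRel
open Literature.NumberTheory.EllipticCurves Literature.NumberTheory.EllipticCurves.GreenbergSelmer
open Literature.NumberTheory.EllipticCurves.GreenbergVatsal2000
open Literature.NumberTheory.GaloisRepresentations
open Summit.BirchSwinnertonDyer.Rank1Residual.X11b.LocBridge
open Summit.BirchSwinnertonDyer.BirchSwinnertonDyer.Theorems.PrintCf2.LayerShapiro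

namespace Summit.BirchSwinnertonDyer.BirchSwinnertonDyer.Theorems.PrintCf2.LayerShapiro

section DoubleCosets

universe u
variable {G D : Type u} [Group G] [Group D] [TopologicalSpace G] [TopologicalSpace D]

/-! ## §1. Orbit representatives from the double-coset quotient -/

/-- **`(q, y') ↦ ē(y')·(q.out N)` is a bijection `(Δ \\ G / N) × (D ⧸ θ⁻¹N) ≃ G ⧸ N`** for `N ⊴ G`, `θ : D → G` and `Δ = θ(D)`
(`hΔ`): the canonical representatives `Quotient.out` of the double cosets `Δ \\ G / N` (= the places of `K̄^N` above the place of `Δ`)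
are orbit representatives in the sense of the tree's Mackey theorems (`exists_cohomologyMap_resCoindFinHomR_eq`, hypothesis `hbij`).
Injective: equal products lie in one double coset (`DoubleCoset.eq`, `out_eq'`), then cancel and use `quotientMapOfHom_injective`;
surjective: `(mk g).out = δ g u` (`DoubleCoset.mk_out_eq_mul`) with `δ = θ d`, so `g N = ē(d⁻¹)·(out N)`.
[cite: Brown1982, III §5 (5.6)(b)] [cite: NeukirchSchmidtWingberg2008, I §5 (1.5.6)–(1.5.7)] -/
theorem bijective_quotientMapOfHom_mul_out (N : Subgroup G) [N.Normal] (θ : D →ₜ* G) (Δ : Subgroup G)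
    (hΔ : ∀ g, g ∈ Δ ↔ ∃ d, θ d = g) :
    Function.Bijective fun q : DoubleCoset.Quotient (Δ : Set G) (N : Set G) × (D ⧸ N.comap (θ : D →* G)) =>
      quotientMapOfHom N θ q.2 * (q.1.out : G ⧸ N) := by
  constructor
  · rintro ⟨q₁, y₁⟩ ⟨q₂, y₂⟩ h
    induction y₁ using QuotientGroup.induction_on with
    | H d₁ =>
    induction y₂ using QuotientGroup.induction_on with
    | H d₂ =>
    change quotientMapOfHom N θ (d₁ : D ⧸ N.comap (θ : D →* G)) * (q₁.out : G ⧸ N) =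
      quotientMapOfHom N θ (d₂ : D ⧸ N.comap (θ : D →* G)) * (q₂.out : G ⧸ N) at h
    rw [quotientMapOfHom_mk, quotientMapOfHom_mk, ← QuotientGroup.mk_mul, ← QuotientGroup.mk_mul, QuotientGroup.eq] at h
    -- the double cosets agree
    have hq : q₁ = q₂ := by
      rw [← DoubleCoset.out_eq' Δ N q₁, ← DoubleCoset.out_eq' Δ N q₂, DoubleCoset.eq]
      refine ⟨θ (d₂⁻¹ * d₁), (hΔ _).2 ⟨_, rfl⟩, (θ d₁ * q₁.out)⁻¹ * (θ d₂ * q₂.out), h, ?_⟩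
      rw [map_mul, map_inv]; group
    subst hq
    have hd : ((θ d₁ : G) : G ⧸ N) = ((θ d₂ : G) : G ⧸ N) := by
      have h' : ((θ d₁ * q₁.out : G) : G ⧸ N) = ((θ d₂ * q₁.out : G) : G ⧸ N) := by
        rw [QuotientGroup.eq]; exact h
      rw [QuotientGroup.mk_mul, QuotientGroup.mk_mul] at h'
      exact mul_right_cancel h'
    have hy : (d₁ : D ⧸ N.comap (θ : D →* G)) = (d₂ : D ⧸ N.comap (θ : D →* G)) :=
      quotientMapOfHom_injective N θ (by rw [quotientMapOfHom_mk, quotientMapOfHom_mk]; exact hd)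
    rw [hy]
  · intro y
    induction y using QuotientGroup.induction_on with
    | H g =>
    obtain ⟨δ, u, hδ, hu, hout⟩ := DoubleCoset.mk_out_eq_mul Δ N g
    obtain ⟨d, rfl⟩ := (hΔ δ).1 hδ
    refine ⟨(DoubleCoset.mk Δ N g, ((d⁻¹ : D) : D ⧸ N.comap (θ : D →* G))), ?_⟩
    change quotientMapOfHom N θ ((d⁻¹ : D) : D ⧸ N.comap (θ : D →* G)) *
      (((DoubleCoset.mk Δ N g : DoubleCoset.Quotient (Δ : Set G) (N : Set G)).out : G) : G ⧸ N) = (g : G ⧸ N)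
    rw [quotientMapOfHom_mk, hout, ← QuotientGroup.mk_mul, QuotientGroup.eq, map_inv]
    rw [show ((θ d)⁻¹ * (θ d * g * u))⁻¹ * g = u⁻¹ by group]
    exact N.inv_mem hu

end DoubleCosets

section Reading

variable {K : Type} [Field K] [NumberField K]
variable {M₀ M : Type} [AddCommGroup M₀] [DistribMulAction (absoluteGaloisGroup K) M₀] [TopologicalSpace M₀] [DiscreteTopology M₀]
  [AddCommGroup M] [DistribMulAction (absoluteGaloisGroup K) M] [TopologicalSpace M] [DiscreteTopology M]
  (hM₀ : ∀ m : M₀, IsOpen {σ : absoluteGaloisGroup K | σ • m = m})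
  (hM : ∀ m : M, IsOpen {σ : absoluteGaloisGroup K | σ • m = m})
  (U : Subgroup (absoluteGaloisGroup K)) [U.Normal] (hU : IsOpen (U : Set (absoluteGaloisGroup K)))
  [Fintype (absoluteGaloisGroup K ⧸ U)] {s : absoluteGaloisGroup K ⧸ U → absoluteGaloisGroup K}
  (hs : ∀ y, (s y : absoluteGaloisGroup K ⧸ U) = y) (hs1 : s ((1 : absoluteGaloisGroup K) : absoluteGaloisGroup K ⧸ U) = 1)
  (w : HeightOneSpectrum (𝓞 K))

/-! ## §2. The component reading -/

set_option maxHeartbeats 400000 in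
/-- **THE COMPONENT READING (two levels at once).** See the module docstring: for layer-local targets `τ₀ q ∈ H¹(U ⊓ D_w, M₀)` at the places
`q ∈ D_w \\ Γ_K / U` of `K̄^U` above `w` there is a local class `t₀ ∈ H¹(K_w, Maps(Γ_K ⧸ U, M₀))` such that, for every layer class
`z ∈ H¹(U, M)`, if the localisation at `w` of the Shapiro lift `Sh z` agrees with the push-forward `H¹(ιc_w) t₀` MODULO UNRAMIFIED classes,
then at every `q` the restriction of `conj_{q.out} z` to `U ⊓ D_w` agrees with `j_* (τ₀ q)` modulo classes dying on `U ⊓ I_w`.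
[cite: Brown1982, III §5 (5.6)(b)] [cite: NeukirchSchmidtWingberg2008, I §6 Prop. (1.6.4)–(1.6.5)] [cite: GreenbergVatsal2000, §2 Prop. 2.1] -/
theorem exists_localClass_reading
    (ιc : ((ofSMul M₀ hM₀).coind U hU).toContRepresentation →ⁱL ((ofSMul M hM).coind U hU).toContRepresentation)
    (j : M₀ →+ M) (hj : ∀ (σ : absoluteGaloisGroup K) (m : M₀), j (σ • m) = σ • j m)
    (hιc : ∀ (φ : absoluteGaloisGroup K ⧸ U → M₀) (y : absoluteGaloisGroup K ⧸ U), ιc φ y = j (φ y))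
    (τ₀ : DoubleCoset.Quotient (decomp (K := K) w : Set (absoluteGaloisGroup K)) (U : Set (absoluteGaloisGroup K)) →
      subgroupH1 (decompIn U w) M₀) :
    ∃ t₀ : galoisCohomology (((ofSMul M₀ hM₀).coind U hU).toLocal (Sum.inr w)) 1,
      ∀ z : subgroupH1 U M,
        galoisCohomology.localization ((ofSMul M hM).coind U hU) (Sum.inr w) 1
            (shapiroLift (ofSMul M hM).toTopRep U hU hs hs1 z) -
          DiscreteGaloisModule.localMap ιc (Sum.inr w) t₀ ∈
          DiscreteGaloisModule.unramifiedSubgroup (GaloisRep.toLocal w ((ofSMul M hM).coind U hU)) 1 →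
        ∀ q, resOfLe M (inertiaIn_le_decompIn U w)
            (resH1Hom (decompInToH U w) (AddMonoidHom.id M) (fun _ _ ↦ rfl) (conjH1 U M q.out z) -
              resH1Hom (ContinuousMonoidHom.id (decompIn U w)) j (fun _ m ↦ hj _ m) (τ₀ q)) = 0 := by
  -- the local group, the inertia inclusion, the projection `π : θ⁻¹U → U ⊓ D_w`
  let θ : absoluteGaloisGroup (w.adicCompletion K) →ₜ* absoluteGaloisGroup K := absGaloisRestrict K (w.adicCompletion K)
  let incl : ↥(absInertia (w.adicCompletion K)) →ₜ* absoluteGaloisGroup (w.adicCompletion K) :=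
    Literature.NumberTheory.GaloisRepresentations.subgroupIncl (absInertia (w.adicCompletion K))
  let ND : Subgroup (absoluteGaloisGroup (w.adicCompletion K)) :=
    U.comap (θ : absoluteGaloisGroup (w.adicCompletion K) →* absoluteGaloisGroup K)
  let π : ↥ND →ₜ* ↥(decompIn U w) :=
    { toFun := fun d ↦ ⟨⟨θ (d : absoluteGaloisGroup (w.adicCompletion K)), (mem_decomp_iff w _).2 ⟨_, rfl⟩⟩,
        (mem_decompIn_iff U w _).2 (Subgroup.mem_comap.1 d.2)⟩
      map_one' := Subtype.ext (Subtype.ext (by simp))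
      map_mul' := fun a b ↦ Subtype.ext (Subtype.ext (by simp))
      continuous_toFun := ((θ.continuous.comp continuous_subtype_val).subtype_mk _).subtype_mk _ }
  -- the two modules as `D`-representations and the maps induced by `j` / `ιc`
  let X₀ := (ofSMul M₀ hM₀).toTopRep
  let X := (ofSMul M hM).toTopRep
  let JD : TopRep.res (θ : absoluteGaloisGroup (w.adicCompletion K) →* absoluteGaloisGroup K) X₀ ⟶
      TopRep.res (θ : absoluteGaloisGroup (w.adicCompletion K) →* absoluteGaloisGroup K) X :=
    TopRep.ofHom ⟨⟨j.toIntLinearMap, continuous_of_discreteTopology⟩, fun d ↦ by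
      ext m
      exact hj (θ d) m⟩
  let ID : TopRep.res (θ : absoluteGaloisGroup (w.adicCompletion K) →* absoluteGaloisGroup K) (coindFin X₀ U) ⟶
      TopRep.res (θ : absoluteGaloisGroup (w.adicCompletion K) →* absoluteGaloisGroup K) (coindFin X U) :=
    TopRep.ofHom ⟨ιc.toContinuousLinearMap, fun d ↦ ιc.isIntertwining' (θ d)⟩
  -- cocycles of the targets and their pull-backs to `θ⁻¹U`
  choose g hg using fun q ↦ oneCocycleClass_surjective (discreteTopRep (decompIn U w) M₀) (τ₀ q)
  let fπ : TopRep.res (π : ↥ND →* ↥(decompIn U w)) (discreteTopRep (decompIn U w) M₀) ⟶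
      subgroupRep (TopRep.res (θ : absoluteGaloisGroup (w.adicCompletion K) →* absoluteGaloisGroup K) X₀) ND :=
    TopRep.ofHom ⟨ContinuousLinearMap.id ℤ M₀, fun _ ↦ rfl⟩
  let b := fun q ↦ contOneCocycles.pullback π fπ (g q)
  -- representatives and the Mackey bijection for the double cosets
  obtain ⟨sD, hsD, hsD1⟩ := exists_reps_one (N := ND)
  have hbij := bijective_quotientMapOfHom_mul_out U θ (decomp (K := K) w) (mem_decomp_iff w)
  -- the local class with prescribed components
  obtain ⟨t₀, ht₀⟩ := exists_cohomologyMap_resCoindFinHomR_eq_shapiroLift X₀ U θ hU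
    (fun q : DoubleCoset.Quotient (decomp (K := K) w : Set (absoluteGaloisGroup K)) (U : Set (absoluteGaloisGroup K)) ↦ q.out)
    hbij hsD hsD1 (fun q ↦ oneCocycleClass _ (b q))
  refine ⟨t₀, fun z hunr q ↦ ?_⟩
  obtain ⟨f, rfl⟩ := oneCocycleClass_surjective (subgroupRep X U) z
  -- the orbit projections at `q`
  let Φq := resCoindFinHomR X U θ (q.out : absoluteGaloisGroup K ⧸ U)
  let Φq₀ := resCoindFinHomR X₀ U θ (q.out : absoluteGaloisGroup K ⧸ U)
  -- ### (1) the push-forward of `t₀` in the Mackey model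
  have hpush : DiscreteGaloisModule.localMap ιc (Sum.inr w) t₀ = cohomologyMap ID 1 t₀ := by
    obtain ⟨T₀, rfl⟩ := oneCocycleClass_surjective
      (DiscreteGaloisModule.toTopRep (GaloisRep.toLocal w ((ofSMul M₀ hM₀).coind U hU))) t₀
    change galoisCohomology.map (ιc.restrictField (w.adicCompletion K)) 1
        (oneCocycleClass (DiscreteGaloisModule.toTopRep
          (GaloisRep.restrictField (w.adicCompletion K) ((ofSMul M₀ hM₀).coind U hU))) T₀) =
      cohomologyMap ID 1 (oneCocycleClass
        (TopRep.res (θ : absoluteGaloisGroup (w.adicCompletion K) →* absoluteGaloisGroup K) (coindFin X₀ U)) T₀)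
    rw [galoisCohomology.map_one_oneCocycleClass, cohomologyMap_oneCocycleClass]
    rfl
  -- ### (2) the unramified difference, in the Mackey model: it dies on `absInertia K_w`
  obtain ⟨Fu, hFu⟩ := oneCocycleClass_surjective
    (TopRep.res (θ : absoluteGaloisGroup (w.adicCompletion K) →* absoluteGaloisGroup K) (coindFin X U))
    (ContinuousCohomology.map θ
        (𝟙 (TopRep.res (θ : absoluteGaloisGroup (w.adicCompletion K) →* absoluteGaloisGroup K) (coindFin X U))) 1
        (shapiroLift X U hU hs hs1 (oneCocycleClass _ f)) - cohomologyMap ID 1 t₀)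
  have hunr' : oneCocycleClass (DiscreteGaloisModule.toTopRep (GaloisRep.toLocal w ((ofSMul M hM).coind U hU))) Fu ∈
      DiscreteGaloisModule.unramifiedSubgroup (GaloisRep.toLocal w ((ofSMul M hM).coind U hU)) 1 := by
    have key : galoisCohomology.localization ((ofSMul M hM).coind U hU) (Sum.inr w) 1
          (shapiroLift (ofSMul M hM).toTopRep U hU hs hs1 (oneCocycleClass _ f)) -
          DiscreteGaloisModule.localMap ιc (Sum.inr w) t₀ =
        oneCocycleClass (DiscreteGaloisModule.toTopRep (GaloisRep.toLocal w ((ofSMul M hM).coind U hU))) Fu := by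
      rw [hpush]
      exact hFu.symm
    rw [← key]
    exact hunr
  obtain ⟨Φ, hΦ⟩ := (DiscreteGaloisModule.oneCocycleClass_mem_unramifiedSubgroup_iff_exists
    (GaloisRep.toLocal w ((ofSMul M hM).coind U hU)) Fu).1 hunr'
  -- ### (3) its `q`-component dies on `absInertia K_w`
  have hcompI : ContinuousCohomology.map incl
      (𝟙 (TopRep.res (incl : ↥(absInertia (w.adicCompletion K)) →* absoluteGaloisGroup (w.adicCompletion K))
        (coindFin (TopRep.res (θ : absoluteGaloisGroup (w.adicCompletion K) →* absoluteGaloisGroup K) X) ND))) 1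
      (cohomologyMap Φq 1 (oneCocycleClass _ Fu)) = 0 := by
    let Φm : (TopRep.res (θ : absoluteGaloisGroup (w.adicCompletion K) →* absoluteGaloisGroup K) (coindFin X U)) := Φ
    have hΦ' : ∀ τ ∈ absInertia (w.adicCompletion K), Fu.1 τ =
        (TopRep.res (θ : absoluteGaloisGroup (w.adicCompletion K) →* absoluteGaloisGroup K) (coindFin X U)).ρ τ Φm - Φm :=
      hΦ
    rw [cohomologyMap_oneCocycleClass, map_oneCocycleClass_eq_zero_iff _ _ incl (𝟙 _) Function.bijective_id]
    refine ⟨Φq.hom Φm, fun l ↦ ?_⟩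
    rw [pullback_id_resIdHom_apply]
    change Φq.hom (Fu.1 (l : absoluteGaloisGroup (w.adicCompletion K))) = _
    rw [hΦ' l l.2, map_sub, TopRep.hom_comm_apply]
    rfl
  -- ### (4) the `q`-component of the localised Shapiro lift
  have hShq : cohomologyMap Φq 1 (ContinuousCohomology.map θ
        (𝟙 (TopRep.res (θ : absoluteGaloisGroup (w.adicCompletion K) →* absoluteGaloisGroup K) (coindFin X U))) 1
        (shapiroLift X U hU hs hs1 (oneCocycleClass _ f))) =
      shapiroLift (TopRep.res (θ : absoluteGaloisGroup (w.adicCompletion K) →* absoluteGaloisGroup K) X) ND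
        (isOpen_comap U θ hU) hsD hsD1
        (ContinuousCohomology.map (comapSubtypeHom U θ) (comapCoeffHom X U θ) 1
          (conjMap X U q.out 1 (oneCocycleClass _ f))) := by
    rw [← map_resCoindFinHomR_shapiroLift X U θ hU hs hs1 hsD hsD1 q.out (oneCocycleClass _ f)]
    simp only [shapiroLift_oneCocycleClass, map_oneCocycleClass]
    rfl
  -- ### (5) the `q`-component of the push-forward
  have hpushq : cohomologyMap Φq 1 (cohomologyMap ID 1 t₀) =
      shapiroLift (TopRep.res (θ : absoluteGaloisGroup (w.adicCompletion K) →* absoluteGaloisGroup K) X) ND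
        (isOpen_comap U θ hU) hsD hsD1 (cohomologyMap (subgroupRepMap JD ND) 1 (oneCocycleClass _ (b q))) := by
    rw [shapiroLift_cohomologyMap, ← ht₀ q]
    obtain ⟨T₀, rfl⟩ := oneCocycleClass_surjective
      (TopRep.res (θ : absoluteGaloisGroup (w.adicCompletion K) →* absoluteGaloisGroup K) (coindFin X₀ U)) t₀
    rw [cohomologyMap_oneCocycleClass, cohomologyMap_oneCocycleClass, cohomologyMap_oneCocycleClass,
      cohomologyMap_oneCocycleClass]
    refine congrArg (oneCocycleClass _) (Subtype.ext (ContinuousMap.ext fun d ↦ funext fun y' ↦ ?_))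
    simp only [pullback_id_resIdHom_apply, coindFinMap_apply]
    exact hιc _ _
  -- ### (6) hence the difference of the layer-local classes dies on `θ⁻¹U ⊓ absInertia`
  obtain ⟨sI, hsI, hsI1⟩ := exists_reps_one
    (N := ND.comap (incl : ↥(absInertia (w.adicCompletion K)) →* absoluteGaloisGroup (w.adicCompletion K)))
  -- the layer-local difference cocycle
  let fq := contOneCocycles.pullback (subgroupConj U q.out) (conjRepHom X U q.out) f
  let c : contOneCocycles (subgroupRep (TopRep.res (θ : absoluteGaloisGroup (w.adicCompletion K) →* absoluteGaloisGroup K) X) ND) :=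
    contOneCocycles.pullback (comapSubtypeHom U θ) (comapCoeffHom X U θ) fq -
      contOneCocycles.pullback (ContinuousMonoidHom.id _) (resIdHom (subgroupRepMap JD ND)) (b q)
  have hc : ContinuousCohomology.map (comapSubtypeHom U θ) (comapCoeffHom X U θ) 1 (conjMap X U q.out 1 (oneCocycleClass _ f)) -
      cohomologyMap (subgroupRepMap JD ND) 1 (oneCocycleClass _ (b q)) = oneCocycleClass _ c := by
    rw [conjMap_oneCocycleClass, map_oneCocycleClass, cohomologyMap_oneCocycleClass, ← oneCocycleClass_sub]
  have hdies : ContinuousCohomology.map incl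
      (𝟙 (TopRep.res (incl : ↥(absInertia (w.adicCompletion K)) →* absoluteGaloisGroup (w.adicCompletion K))
        (coindFin (TopRep.res (θ : absoluteGaloisGroup (w.adicCompletion K) →* absoluteGaloisGroup K) X) ND))) 1
      (shapiroLift (TopRep.res (θ : absoluteGaloisGroup (w.adicCompletion K) →* absoluteGaloisGroup K) X) ND
        (isOpen_comap U θ hU) hsD hsD1 (oneCocycleClass _ c)) = 0 := by
    have e : shapiroLift (TopRep.res (θ : absoluteGaloisGroup (w.adicCompletion K) →* absoluteGaloisGroup K) X) ND
        (isOpen_comap U θ hU) hsD hsD1 (oneCocycleClass _ c) = cohomologyMap Φq 1 (oneCocycleClass _ Fu) := by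
      rw [← hc, map_sub, ← hShq, ← hpushq, ← map_sub, ← hFu]
    rw [e]
    exact hcompI
  have hdet := map_comapCoeffHom_conjMap_eq_zero_of_map_shapiroLift_eq_zero
    (TopRep.res (θ : absoluteGaloisGroup (w.adicCompletion K) →* absoluteGaloisGroup K) X) ND incl
    (isOpen_comap U θ hU) hsD hsD1 hsI hsI1 (oneCocycleClass _ c) hdies 1
  rw [conjMap_eq_self_of_mem_one _ _ ND.one_mem, map_oneCocycleClass_eq_zero_iff _ _ _ _ Function.bijective_id] at hdet
  obtain ⟨v, hv⟩ := hdet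
  -- ### (7) read back in the line's currency
  have e1 : conjH1 U M q.out (oneCocycleClass (subgroupRep X U) f) = oneCocycleClass (subgroupRep X U) fq :=
    conjMap_oneCocycleClass X U q.out f
  have e2 : resH1Hom (decompInToH U w) (AddMonoidHom.id M) (fun _ _ ↦ rfl) (oneCocycleClass (subgroupRep X U) fq) =
      oneCocycleClass _ (contOneCocycles.pullback (decompInToH U w)
        (resHomOfEquivariant (decompInToH U w) (AddMonoidHom.id M) (fun _ _ ↦ rfl)) fq) :=
    map_oneCocycleClass _ _ _ fq
  have e3 : resH1Hom (ContinuousMonoidHom.id (decompIn U w)) j (fun x m ↦ hj _ m) (τ₀ q) =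
      oneCocycleClass _ (contOneCocycles.pullback (ContinuousMonoidHom.id (decompIn U w))
        (resHomOfEquivariant (ContinuousMonoidHom.id (decompIn U w)) j (fun x m ↦ hj _ m)) (g q)) := by
    rw [← hg q]; exact map_oneCocycleClass _ _ _ (g q)
  rw [e1, e2, e3, ← oneCocycleClass_sub, resOfLe]
  have e4 := map_oneCocycleClass (discreteTopRep (decompIn U w) M) (subgroupInclusion (inertiaIn_le_decompIn U w))
    (resHomOfEquivariant (subgroupInclusion (inertiaIn_le_decompIn U w)) (AddMonoidHom.id M) (fun _ _ ↦ rfl))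
    (contOneCocycles.pullback (decompInToH U w)
        (resHomOfEquivariant (decompInToH U w) (AddMonoidHom.id M) (fun _ _ ↦ rfl)) fq -
      contOneCocycles.pullback (ContinuousMonoidHom.id (decompIn U w))
        (resHomOfEquivariant (ContinuousMonoidHom.id (decompIn U w)) j (fun x m ↦ hj _ m)) (g q))
  refine (e4.trans ((oneCocycleClass_eq_zero_iff _ _).2 ⟨v, fun x ↦ ?_⟩))
  -- `x ∈ U ⊓ I_w ⊓ D_w` comes from `τ ∈ absInertia K_w` with `θ τ ∈ U`
  have hxI : ((x : decomp (K := K) w) : absoluteGaloisGroup K) ∈ inertia w := ((mem_inertiaIn_iff U w _).1 x.2).2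
  have hxU : ((x : decomp (K := K) w) : absoluteGaloisGroup K) ∈ U := ((mem_inertiaIn_iff U w _).1 x.2).1
  obtain ⟨τ, hτ, hτx⟩ := Subgroup.mem_map.1 hxI
  have hd : (⟨τ, hτ⟩ : ↥(absInertia (w.adicCompletion K))) ∈
      ND.comap (incl : ↥(absInertia (w.adicCompletion K)) →* absoluteGaloisGroup (w.adicCompletion K)) := by
    rw [Subgroup.mem_comap, Subgroup.mem_comap]
    change absGaloisRestrict K (w.adicCompletion K) τ ∈ U
    rw [show absGaloisRestrict K (w.adicCompletion K) τ = _ from hτx]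
    exact hxU
  have hv' := hv ⟨⟨τ, hτ⟩, hd⟩
  -- identify the two evaluation points
  have hU1 : decompInToH U w (subgroupInclusion (inertiaIn_le_decompIn U w) x) =
      comapSubtypeHom U θ (comapSubtypeHom ND incl ⟨⟨τ, hτ⟩, hd⟩) := by
    apply Subtype.ext
    rw [comapSubtypeHom_apply_coe, comapSubtypeHom_apply_coe]
    exact hτx.symm
  have hπ1 : subgroupInclusion (inertiaIn_le_decompIn U w) x = π (comapSubtypeHom ND incl ⟨⟨τ, hτ⟩, hd⟩) := by
    apply Subtype.ext; apply Subtype.ext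
    change ((x : decomp (K := K) w) : absoluteGaloisGroup K) = θ (incl ⟨τ, hτ⟩)
    exact hτx.symm
  rw [contOneCocycles.pullback_apply]
  change ((contOneCocycles.pullback (decompInToH U w)
        (resHomOfEquivariant (decompInToH U w) (AddMonoidHom.id M) (fun _ _ ↦ rfl)) fq).1 -
      (contOneCocycles.pullback (ContinuousMonoidHom.id (decompIn U w))
        (resHomOfEquivariant (ContinuousMonoidHom.id (decompIn U w)) j (fun x m ↦ hj _ m)) (g q)).1)
      (subgroupInclusion (inertiaIn_le_decompIn U w) x) =
    ((x : decomp (K := K) w) : absoluteGaloisGroup K) • v - v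
  rw [ContinuousMap.sub_apply, contOneCocycles.pullback_apply, contOneCocycles.pullback_apply, hU1]
  change fq.1 _ - j ((g q).1 (subgroupInclusion (inertiaIn_le_decompIn U w) x)) = _
  rw [hπ1]
  have hv'' : fq.1 (comapSubtypeHom U θ (comapSubtypeHom ND incl ⟨⟨τ, hτ⟩, hd⟩)) -
      j ((g q).1 (π (comapSubtypeHom ND incl ⟨⟨τ, hτ⟩, hd⟩))) =
      (θ (incl ⟨τ, hτ⟩)) • v - v := hv'
  rw [hv'']
  change (absGaloisRestrict K (w.adicCompletion K) τ) • v - v = _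
  rw [show absGaloisRestrict K (w.adicCompletion K) τ = _ from hτx]

end Reading

end Summit.BirchSwinnertonDyer.BirchSwinnertonDyer.Theorems.PrintCf2.LayerShapiro

end
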